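import Summits.QuantumFields.YangMills.Theorems.ParabolicTrajectoryLatticeGapOnTrajectoryStubTorusRange
import HarnessLib

/-!
# Crux `LatticeGapOnTrajectory` (stmt-QuantumFields-10523), line `sparse-defect-orbit-window`:
# stub (T1) `stub_roughCentreCrude` — the rough-centre bound at the crude constant

Registered stub (T1) of the line skeleton, `--supports stmt-QuantumFields-10523` (G-blind TOOL;
nothing about mass gaps is asserted, everything here is proved).

For axis frames `q i : ℤ/(2S+1) → ℤ/(μ i + 1)` of scale `b`, EVERY coupling `β`, resolution `α > 0`,
window radius `n₀` and support size `s`, the rough-centre bound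
`RoughCentreBound r β (2S+1) q α n₀ s K` holds with the CRUDE constant
`K = (2n₀+3)⁴ · 2(1 + 2e²|β|α·7680 b⁴)`: the window average `γ_{W(c)} f` of a bounded measurable `f`
read on links of the central cell `c` is cell-Lipschitz in the capped orbit weight with bounds
`δ y = 2B(1 + 2e²|β|α·7680 b⁴)` on the shell `cdist c y = n₀ + 1` and `0` elsewhere.

Proof. Cells inside the window do not move `γ_{W(c)} f` (the kernel `torusYM … Λ η` reads `η` only
off `Λ`: `glueWith`, `StubRoughCentreCrude.torusYM_congr`); cells beyond the shell do not either
(finite range one cell, `stub_torusRange`); a shell cell moves it by at most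
`2B(1 + 2e²|β|α·7680 b⁴) · w_y` (`SlabClustering.abs_windowAvg_sub_le_orbitWeight_frame`). The shell
has at most `(2(n₀+1)+1)⁴ = (2n₀+3)⁴` cells (`KRFiniteSize.card_filter_cdist_le`). `B ≥ 0` because
configurations exist. This records that the physics content of `RoughCentreBound` in the line's
physics core is only the `k`-uniformity of `K`.
-/

set_option autoImplicit false

noncomputable section

namespace Summit.QuantumFields.YangMills.Cruxes.LatticeGapOnTrajectory.SparseDefectOrbitWindow

open Filter MeasureTheory
open Literature.Probability.LatticeModels (Specification IsSpecification IsGibbsMeasure glueWith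
  glueWith_apply_mem glueWith_apply_not_mem)
open Literature.MathematicalPhysics.QuantumFieldTheory
open Summit.QuantumFields.YangMills.Cruxes.LatticeGapOnTrajectory.OrbitKantorovichFiniteSize

namespace StubRoughCentreCrude

/-! ### The torus kernels ignore the boundary datum inside the window -/

/-- Gluing ignores the boundary datum inside `Λ`: two boundary data equal off `Λ` glue to the same
configuration. -/
theorem glueWith_congr {V S : Type*} (Λ : Finset V) (ζ : ↥Λ → S) {σ τ : V → S}
    (h : ∀ v, v ∉ Λ → σ v = τ v) : glueWith Λ ζ σ = glueWith Λ ζ τ := by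
  funext v
  by_cases hv : v ∈ Λ
  · rw [glueWith_apply_mem _ _ _ hv, glueWith_apply_mem _ _ _ hv]
  · rw [glueWith_apply_not_mem _ _ _ hv, glueWith_apply_not_mem _ _ _ hv]
    exact h v hv

section Kernel

variable {G : Type} [Group G] [TopologicalSpace G] [IsTopologicalGroup G] [CompactSpace G]
  [MeasurableSpace G] [BorelSpace G]

/-- **The kernel `torusYM ρ β N Λ η` reads `η` only off `Λ`.** -/
theorem torusYM_congr {Nr : ℕ} (ρ : G →* Matrix (Fin Nr) (Fin Nr) ℂ) (β : ℝ) {N : ℕ} [NeZero N]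
    (Λ : Finset (Edge 4 N)) {σ τ : GaugeConfig 4 N G} (h : ∀ e, e ∉ Λ → σ e = τ e) :
    torusYM ρ β N Λ σ = torusYM ρ β N Λ τ := by
  have hfun : (fun ζ : ↥Λ → G => glueWith Λ ζ σ) = fun ζ => glueWith Λ ζ τ :=
    funext fun ζ => glueWith_congr Λ ζ h
  unfold torusYM
  rw [hfun]

/-- Hence the window average `γ_Λ f(η)` does not depend on `η` inside `Λ`. -/
theorem windowAvg_torusYM_congr {Nr : ℕ} (ρ : G →* Matrix (Fin Nr) (Fin Nr) ℂ) (β : ℝ) {N : ℕ}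
    [NeZero N] (Λ : Finset (Edge 4 N)) {σ τ : GaugeConfig 4 N G} (h : ∀ e, e ∉ Λ → σ e = τ e)
    (f : GaugeConfig 4 N G → ℝ) :
    windowAvg (torusYM ρ β N) Λ f σ = windowAvg (torusYM ρ β N) Λ f τ := by
  unfold windowAvg
  rw [torusYM_congr ρ β Λ h]

end Kernel

/-- The capped orbit weight is non-negative (for `α > 0`). -/
theorem orbitWeight_nonneg {G : Type} [Group G] [TopologicalSpace G] (r : LatticeRep G) {α : ℝ}
    (hα : 0 < α) {N : ℕ} {μ : Fin 4 → ℕ} (q : (i : Fin 4) → ZMod N → ZMod (μ i + 1))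
    (c : CoarseIdx μ) (U U' : GaugeConfig 4 N G) : 0 ≤ orbitWeight r α q c U U' :=
  le_min zero_le_one (div_nonneg (SlabClustering.cellDev_nonneg r q c U U') hα.le)

/-! ### The shell of a window has at most `(2n₀+3)⁴` cells -/

/-- **Shell count.** At most `(2n₀+3)⁴` cells lie at coarse distance exactly `n₀ + 1` from a given
cell (the shell lies in the ball of radius `n₀ + 1`, `KRFiniteSize.card_filter_cdist_le`). -/
theorem card_shell_le {μ : Fin 4 → ℕ} (c : CoarseIdx μ) (n₀ : ℕ) :
    (Finset.univ.filter fun y : CoarseIdx μ => cdist c y = n₀ + 1).card ≤ (2 * n₀ + 3) ^ 4 := by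
  calc (Finset.univ.filter fun y : CoarseIdx μ => cdist c y = n₀ + 1).card
      ≤ (Finset.univ.filter fun y : CoarseIdx μ => cdist y c ≤ n₀ + 1).card := by
        refine Finset.card_le_card fun y hy => ?_
        rw [Finset.mem_filter] at hy ⊢
        exact ⟨hy.1, by rw [KRFiniteSize.cdist_comm]; exact hy.2.le⟩
    _ ≤ (2 * (n₀ + 1) + 1) ^ 4 := KRFiniteSize.card_filter_cdist_le (n₀ + 1) c
    _ = (2 * n₀ + 3) ^ 4 := by ring

end StubRoughCentreCrude

/-- **Stub (T1) `stub_roughCentreCrude`** (G-blind TOOL, M): the rough-centre bound at the crude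
constant. For axis frames `q` of scale `b` on the torus of side `2S+1`, every coupling `β`, resolution
`α > 0`, radius `n₀` and support size `s`:
`RoughCentreBound r β (2S+1) q α n₀ s ((2n₀+3)⁴ · 2(1 + 2e²|β|α·7680 b⁴))`. Route: for `f` read on
`E ⊆ cell c` (`⊆ W(c)`), take `δ y := 2B(1 + 2e²|β|α·7680 b⁴)` on shell cells (`cdist c y = n₀ + 1`) and
`0` elsewhere; cells inside the window do not move `γ_{W(c)} f` (the kernel `torusYM … Λ η` reads `η`
only off `Λ`: `glueWith`), cells beyond the shell do not either (`stub_torusRange`), shell cells by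
`SlabClustering.abs_windowAvg_sub_le_orbitWeight_frame`; `#shell ≤ (2n₀+3)⁴` (the shell lies in the
ball of radius `n₀ + 1`). `B ≥ 0` because configurations exist. -/
theorem stub_roughCentreCrude :
    ∀ (G : Type) [Group G] [TopologicalSpace G] [IsTopologicalGroup G] [CompactSpace G]
      [MeasurableSpace G] [BorelSpace G] (r : LatticeRep G) (β α : ℝ), 0 < α →
      ∀ {S : ℕ} {μ : Fin 4 → ℕ} (q : (i : Fin 4) → ZMod (2 * S + 1) → ZMod (μ i + 1)) {b : ℕ},
      (∀ i, IsTorusFrame (2 * S + 1) b (q i)) → ∀ (n₀ s : ℕ),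
        RoughCentreBound r β (2 * S + 1) q α n₀ s
          ((2 * (n₀ : ℝ) + 3) ^ 4 * (2 * (1 + 2 * Real.exp 2 * |β| * α * (7680 * (b : ℝ) ^ 4)))) := by
  intro G _ _ _ _ _ _ r β α hα S μ q b hq n₀ s c f E B _ hE hdep hf hfb
  classical
  -- notation: the window and the TV constant
  set Λ : Finset (Edge 4 (2 * S + 1)) := windowVol (cellOf q) n₀ c with hΛ
  set A : ℝ := 1 + 2 * Real.exp 2 * |β| * α * (7680 * (b : ℝ) ^ 4) with hA
  have hB : 0 ≤ B := (abs_nonneg _).trans (hfb fun _ => 1)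
  have hA0 : 0 ≤ A := by rw [hA]; positivity
  have hC0 : 0 ≤ 2 * B * A := by positivity
  -- `f` reads only links of the central cell, hence only the window
  have hEn : ∀ e ∈ E, cdist c (cellOf q e) ≤ n₀ := fun e he => by
    rw [hE e he, KRFiniteSize.cdist_self]
    exact Nat.zero_le _
  have hdepn : DependsOn f {e : Edge 4 (2 * S + 1) | cdist c (cellOf q e) ≤ n₀} :=
    hdep.mono fun e he => hEn e (Finset.mem_coe.1 he)
  have hmemΛ : ∀ e : Edge 4 (2 * S + 1), e ∈ Λ ↔ cdist c (cellOf q e) ≤ n₀ := fun e => by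
    rw [hΛ, windowVol, Finset.mem_filter]
    exact ⟨fun h => h.2, fun h => ⟨Finset.mem_univ _, h⟩⟩
  have hdepΛ : DependsOn f (↑Λ : Set (Edge 4 (2 * S + 1))) :=
    hdep.mono fun e he => Finset.mem_coe.2 ((hmemΛ e).2 (hEn e (Finset.mem_coe.1 he)))
  -- the weight is non-negative
  have hw0 : ∀ (y : CoarseIdx μ) (σ τ : GaugeConfig 4 (2 * S + 1) G), 0 ≤ orbitWeight r α q y σ τ :=
    fun y σ τ => StubRoughCentreCrude.orbitWeight_nonneg r hα q y σ τ
  refine ⟨fun y => if cdist c y = n₀ + 1 then 2 * B * A else 0, ⟨fun y => ?_, fun y σ τ hστ => ?_⟩,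
    fun y hy => ?_, ?_⟩
  · -- `δ ≥ 0`
    split_ifs
    · exact hC0
    · exact le_rfl
  · -- the cell-Lipschitz bound, three cases on the position of `y`
    have hδ0 : 0 ≤ (if cdist c y = n₀ + 1 then 2 * B * A else 0) * orbitWeight r α q y σ τ := by
      refine mul_nonneg ?_ (hw0 y σ τ)
      split_ifs
      · exact hC0
      · exact le_rfl
    rcases lt_trichotomy (cdist c y) (n₀ + 1) with hlt | heq | hgt
    · -- `y` inside the window: the kernel ignores the boundary datum there
      have hστ' : ∀ e, e ∉ Λ → σ e = τ e := by
        intro e he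
        refine hστ e fun hey => he ((hmemΛ e).2 ?_)
        rw [hey]
        omega
      rw [StubRoughCentreCrude.windowAvg_torusYM_congr r.ρ β Λ hστ' f, sub_self, abs_zero]
      exact hδ0
    · -- `y` on the shell: the TV-Lipschitz bound of the torus kernels
      rw [if_pos heq]
      have hy : ∀ e ∈ Λ, cellOf q e ≠ y := by
        intro e he hey
        have he' := (hmemΛ e).1 he
        rw [hey] at he'
        omega
      exact SlabClustering.abs_windowAvg_sub_le_orbitWeight_frame r β α hα q hq Λ y hy hf hdepΛ hfb
        σ τ hστ
    · -- `y` beyond the shell: finite range one cell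
      rw [stub_torusRange G r β q hq n₀ c y hgt σ τ hστ f hf ⟨B, hfb⟩ hdepn, sub_self, abs_zero]
      exact hδ0
  · -- support on the shell
    dsimp only
    rw [if_neg hy]
  · -- the total: `#shell · 2BA ≤ (2n₀+3)⁴ · 2A · B`
    calc ∑ y ∈ Finset.univ.filter (fun y => cdist c y = n₀ + 1),
          (if cdist c y = n₀ + 1 then 2 * B * A else 0)
        = ∑ y ∈ Finset.univ.filter (fun y => cdist c y = n₀ + 1), 2 * B * A :=
          Finset.sum_congr rfl fun y hy => if_pos (Finset.mem_filter.1 hy).2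
      _ = ((Finset.univ.filter fun y : CoarseIdx μ => cdist c y = n₀ + 1).card : ℝ) * (2 * B * A) := by
          rw [Finset.sum_const, nsmul_eq_mul]
      _ ≤ (2 * (n₀ : ℝ) + 3) ^ 4 * (2 * B * A) := by
          refine mul_le_mul_of_nonneg_right ?_ hC0
          exact_mod_cast StubRoughCentreCrude.card_shell_le c n₀
      _ = (2 * (n₀ : ℝ) + 3) ^ 4 * (2 * A) * B := by ring

end Summit.QuantumFields.YangMills.Cruxes.LatticeGapOnTrajectory.SparseDefectOrbitWindow

end
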